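import Summits.PneNP.PneNP.Theorems.KrwChromaticSteeringStrongCompositionLrbQuantitative
import Summits.PneNP.PneNP.Theorems.KrwChromaticSteeringStrongCompositionLrbJointSubspaceHard

/-!
# Crux line `lrb-gluing` (stmt-PneNP-18538): THE RUNG C1|LRB, PROVED — assembly, inclusion of the LRAD rung, non-vacuity

* §1 `strongCompositionLRB_of_quantitative` (VERBATIM the skeleton's kernel-checked composition `assembly_of_quantitative`,
  `Cruxes/StrongComposition/Lines/lrb_gluing.lean` §3): S0⁺ (`KrwLrb.jointSubspaceHard_exists`) and the adversary bound
  `KrwLrb.LRBQuantitative` alone give the crux C1 restricted to the class LRB, loss `(c + C + 2) (log₂ (m n) + 1)`; applied to the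
  two PROVED stubs — the bench seat's `KrwLrb.stub_jointSubspaceHard` (`…LrbJointSubspaceHard.lean`, `c = 3`) and
  `KrwLrb.stub_lrbQuantitative` (`…LrbQuantitative.lean`, `C = 1`) —: **`strongCompositionLRB : StrongCompositionLRB`**, the line's
  REGISTERED TARGET (rung).
* §2 `lrb_of_lrad` (LRAD ⊆ LRB tree by tree, adapted from the planner's sketch `P4g20X.lrb_of_lrad`) and
  `strongCompositionLRAD_of_LRB`: the new rung contains the proved rung C1|LRAD (`KrwLrad.strongCompositionLRAD`).
* §3 Non-vacuity (VERBATIM the skeleton's §4): independent play `KWTree.compose` is LRB (`lrb_compose`), so the rung is matched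
  from above inside the class up to its `O(log mn)` loss (`exists_lrb_solvesStrong`).

Honest framing: LRB (label ∨ affine ∨ single-row node tests; no affine test through a row already cut by a single-row test, but
single-row tests on affinely-touched rows allowed) is the smallest disciplined class strictly beyond LRAD on which strong
composition was open (memo `Cruxes/StrongComposition/LensBarrierP4g20.md` §2); above it (type-A nodes: affine tests THROUGH
combinatorial rows, classes LRX_t / LRA) the gluing invariant is not known to survive (memo §3, `LensBarrierP4g21.md`).  A
CLASS-RESTRICTED rung under Meir's open strong composition with `γ = 1` ([Meir2023], FOCS 2023 / arXiv:2306.00615); the crux item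
stmt-PneNP-18538 (C1, all protocols) stays OPEN; nothing here bears on P vs NP.
-/

set_option linter.dupNamespace false -- `Summit.PneNP.PneNP.…`: summit = sub-problem name (D-0017 single-conjunct layout)
set_option autoImplicit false

namespace Summit.PneNP.PneNP.Theorems.KrwLrb

open Literature.Computability.Complexity
open Summit.PneNP.PneNP.Theorems.KrwLrad

/-! ## §1  Assembly: the two stubs give the rung -/
section Assembly

/-- **Assembly of the rung** from S0⁺ and the adversary bound alone (VERBATIM the skeleton's `assembly_of_quantitative`), loss
`(c + C + 2) (log₂ (m n) + 1)` where `c` is the constant of S0⁺ and `C` the stub's additive constant.  Large `n`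
(`c (log₂ n + 1) + 2 ≤ n`, budget `q = n − r − 1 ≥ 1`, `r = c (log₂ n + 1)`): S0⁺'s `g` and the bound in contrapositive form;
tiny `n`: a dictator `g` and the tree's `liftRows` embedding already fit. -/
theorem strongCompositionLRB_of_quantitative (h0 : jointSubspaceHard_exists) (hQ : LRBQuantitative) :
    StrongCompositionLRB := by
  obtain ⟨c, hc⟩ := h0
  obtain ⟨C, hQ⟩ := hQ
  refine ⟨c + C + 2, fun m n hn f hf => ?_⟩
  have hne : ∃ a b, f a = true ∧ f b = false := by
    obtain ⟨a, b, hab⟩ := hf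
    cases ha : f a <;> cases hb : f b
    · rw [ha, hb] at hab; exact absurd rfl hab
    · exact ⟨b, a, hb, ha⟩
    · exact ⟨a, b, ha, hb⟩
    · rw [ha, hb] at hab; exact absurd rfl hab
  have hm : 0 < m := by
    obtain ⟨a, b, hab⟩ := hf
    rcases Nat.eq_zero_or_pos m with h0 | h0
    · exfalso; subst h0; exact hab (congrArg f (funext fun i => i.elim0))
    · exact h0
  set L := Nat.log 2 (m * n) + 1 with hL
  have hLn : Nat.log 2 n + 1 ≤ L := by
    have : Nat.log 2 n ≤ Nat.log 2 (m * n) := Nat.log_mono_right (Nat.le_mul_of_pos_left n hm)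
    omega
  set r := c * (Nat.log 2 n + 1) with hr
  have hcL : r ≤ c * L := Nat.mul_le_mul_left _ hLn
  have hCL : C ≤ C * L := Nat.le_mul_of_pos_right C (by omega)
  have e1 : (c + C + 2) * L = c * L + C * L + 2 * L := by ring
  by_cases hbig : r + 2 ≤ n
  · -- large `n`: S0⁺'s inner function, budget `q = n - r - 1 ≥ 1`
    obtain ⟨g, hgen, hsub⟩ := hc n (by omega)
    refine ⟨g, fun P hP hsol => ?_⟩
    set q := n - r - 1 with hq
    have hq1 : 1 ≤ q := by omega
    have hqn : q + r + 1 ≤ n := by omega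
    by_contra hcon
    push Not at hcon
    set ℓ := P.depth + (c + C + 2) * L + 1 - n with hℓ
    have hH : Hard (f ⁻¹' {true}) (f ⁻¹' {false}) ℓ := by
      intro Q hQs
      have hs : Q.Solves f := fun a b ha hb => hQs a (by simpa using ha) b (by simpa using hb)
      have := hcon Q hs
      omega
    have hmain := hQ m n q r ℓ f g hne hgen hqn hsub hq1 hH P hP hsol
    omega
  · -- tiny `n` (`n ≤ r + 1 ≤ c L + 1`): a dictator and the `liftRows` protocol
    refine ⟨fun x => x ⟨0, by omega⟩, fun P hP hsol => ?_⟩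
    refine ⟨P.comap (KWTree.liftRows (fun _ => true) (fun _ => false))
        (KWTree.liftRows (fun _ => true) (fun _ => false)) Prod.fst,
      KWTree.solves_comap_liftRows hsol rfl rfl, ?_⟩
    rw [KWTree.depth_comap]
    omega

/-- **THE RUNG C1|LRB, PROVED**: Meir's strong composition statement with `γ = 1` (crux C1
`Theses.KrwChromaticSteering.StrongComposition` verbatim: `g` existential, loss `O(log mn)`) holds for every protocol of the class
LRB — the assembly applied to the two proved stubs `stub_jointSubspaceHard` (bench seat, p715652) and `stub_lrbQuantitative`.  This
is the registered target `StrongCompositionLRB` of line `lrb-gluing`; C1 itself (all protocols) stays open. -/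
theorem strongCompositionLRB : StrongCompositionLRB :=
  strongCompositionLRB_of_quantitative stub_jointSubspaceHard stub_lrbQuantitative

end Assembly

/-! ## §2  LRAD ⊆ LRB: the new rung contains the proved one -/

section Inclusion

variable {m n : ℕ}

/-- An affine support meeting no combinatorial row has crossing weight `0`. -/
theorem affWeight_eq_zero {U : Finset (Fin m × Fin n)} {σ : Fin m → RowTypeX}
    (h : ∀ i ∈ eqRows U, σ i ≠ RowTypeX.combinatorial) : affWeight U σ = 0 := by
  unfold affWeight
  rw [Finset.card_eq_zero, Finset.filter_eq_empty_iff]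
  exact fun i hi hc => h i hi hc

/-- An LRAD node is an LRX node of weight `0` from any typing with loads having the same combinatorial rows, and the typings
below it again have the same combinatorial rows [adapted from the planner's sketch `P4g20X.nodeOKX_of_nodeOK`,
`Cruxes/StrongComposition/NextRungP4g20.lean`]. -/
theorem nodeOKX_of_nodeOK {g : (Fin n → Bool) → Bool} {τ τ' : Fin m → RowType} {σ : Fin m → RowTypeX}
    {s : (Fin m × Fin n → Bool) → Bool}
    (hc : ∀ i, τ i = RowType.combinatorial ↔ σ i = RowTypeX.combinatorial) (h : NodeOK g τ s τ') :
    ∃ σ', NodeOKX g σ s σ' 0 ∧ ∀ i, τ' i = RowType.combinatorial ↔ σ' i = RowTypeX.combinatorial := by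
  rcases h with ⟨hl, rfl⟩ | ⟨S, c, hs, htouch, rfl⟩ | ⟨i, ψ, hs, _, rfl⟩
  · exact ⟨σ, Or.inl ⟨hl, rfl, rfl⟩, hc⟩
  · have hσ : ∀ i ∈ eqRows S, σ i ≠ RowTypeX.combinatorial :=
      fun i hi hi' => htouch i hi ((hc i).2 hi')
    refine ⟨retagX S σ, Or.inr (Or.inl ⟨S, c, hs, rfl, (affWeight_eq_zero hσ).symm⟩), fun i => ?_⟩
    by_cases hi : i ∈ eqRows S
    · have h1 : retag S τ i = RowType.algebraic := if_pos hi
      have h2 : retagX S σ i ≠ RowTypeX.combinatorial := by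
        simp only [retagX, if_pos hi, if_neg (hσ i hi)]
        exact fun h => RowTypeX.noConfusion h
      rw [h1]
      exact ⟨fun h => RowType.noConfusion h, fun h => absurd h h2⟩
    · have h1 : retag S τ i = τ i := if_neg hi
      have h2 : retagX S σ i = σ i := if_neg hi
      rw [h1, h2]
      exact hc i
  · refine ⟨Function.update σ i RowTypeX.combinatorial, Or.inr (Or.inr ⟨i, ψ, hs, rfl, rfl⟩), fun i' => ?_⟩
    by_cases hi : i' = i
    · subst hi; simp
    · rw [Function.update_of_ne hi, Function.update_of_ne hi]; exact hc i'

/-- **LRAD ⊆ LRB, tree by tree**: a tree LRAD-disciplined from `τ` is `LRX_0`-disciplined from any typing with loads having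
the same combinatorial rows. -/
theorem lrxOn_zero_of_lradOn (g : (Fin n → Bool) → Bool) :
    ∀ (P : KWTree (Fin m × Fin n)) (τ : Fin m → RowType) (σ : Fin m → RowTypeX),
      (∀ i, τ i = RowType.combinatorial ↔ σ i = RowTypeX.combinatorial) →
      LRADisciplinedOn g τ P → LRXDisciplinedOn g 0 σ P
  | .leaf _, _, _, _, _ => trivial
  | .alice s P Q, τ, σ, hc, h => by
    obtain ⟨τ', hnode, hP, hQ⟩ := h
    obtain ⟨σ', hnode', hc'⟩ := nodeOKX_of_nodeOK hc hnode
    exact ⟨σ', 0, hnode', le_rfl, lrxOn_zero_of_lradOn g P τ' σ' hc' hP,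
      lrxOn_zero_of_lradOn g Q τ' σ' hc' hQ⟩
  | .bob s P Q, τ, σ, hc, h => by
    obtain ⟨τ', hnode, hP, hQ⟩ := h
    obtain ⟨σ', hnode', hc'⟩ := nodeOKX_of_nodeOK hc hnode
    exact ⟨σ', 0, hnode', le_rfl, lrxOn_zero_of_lradOn g P τ' σ' hc' hP,
      lrxOn_zero_of_lradOn g Q τ' σ' hc' hQ⟩

/-- **LRAD ⊆ LRB.** -/
theorem lrb_of_lrad {g : (Fin n → Bool) → Bool} {P : KWTree (Fin m × Fin n)} (h : LRADisciplined g P) :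
    LRBDisciplined g P :=
  lrxOn_zero_of_lradOn g P _ _ (fun _ => ⟨fun h => RowType.noConfusion h, fun h => RowTypeX.noConfusion h⟩) h

/-- **The new rung contains the proved one**: C1|LRB implies C1|LRAD (`KrwLrad.StrongCompositionLRAD`, proved independently
in `…LradQuantitative.lean`). -/
theorem strongCompositionLRAD_of_LRB (h : StrongCompositionLRB) : StrongCompositionLRAD := by
  obtain ⟨c, hc⟩ := h
  refine ⟨c, fun m n hn f hf => ?_⟩
  obtain ⟨g, hg⟩ := hc m n hn f hf
  exact ⟨g, fun P hP hsol => hg P (lrb_of_lrad hP) hsol⟩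

end Inclusion

/-! ## §3  Non-vacuity: independent play is LRB (the rung is matched from above inside the class)
`KWTree.compose g R Q` (run a `KW_f` protocol on the label columns, announce `g(X_i)`, run a `KW_g` protocol on row `i`) uses
label tests and single-row tests only, each of weight `0`, from EVERY typing: so it is `LRX_0`, and `StrongCompositionLRB` says
no LRB protocol beats independent play by more than `O(log mn)` rounds [VERBATIM the skeleton's §4]. -/

section NonVacuity

variable {m n : ℕ}

/-- A row protocol played on row `i` is `LRX_0` from every typing (single-row tests are always legal in LRB). -/
theorem lrxOn_onRow (g : (Fin n → Bool) → Bool) (i : Fin m) :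
    ∀ (R : KWTree (Fin n)) (σ : Fin m → RowTypeX), LRXDisciplinedOn g 0 σ (KWTree.onRow (m := m) i R)
  | .leaf _, _ => trivial
  | .alice s P Q, σ => by
    simp only [KWTree.onRow, KWTree.comap]
    exact ⟨Function.update σ i .combinatorial, 0, Or.inr (Or.inr ⟨i, s, fun X => rfl, rfl, rfl⟩), le_rfl,
      lrxOn_onRow g i P _, lrxOn_onRow g i Q _⟩
  | .bob s P Q, σ => by
    simp only [KWTree.onRow, KWTree.comap]
    exact ⟨Function.update σ i .combinatorial, 0, Or.inr (Or.inr ⟨i, s, fun X => rfl, rfl, rfl⟩), le_rfl,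
      lrxOn_onRow g i P _, lrxOn_onRow g i Q _⟩

/-- The obvious protocol is `LRX_0` from every typing. -/
theorem lrxOn_compose (g : (Fin n → Bool) → Bool) (R : KWTree (Fin n)) :
    ∀ (Q : KWTree (Fin m)) (σ : Fin m → RowTypeX), LRXDisciplinedOn g 0 σ (KWTree.compose g R Q)
  | .leaf i, σ => by
    simp only [KWTree.compose]
    exact ⟨Function.update σ i .combinatorial, 0, Or.inr (Or.inr ⟨i, g, fun X => rfl, rfl, rfl⟩), le_rfl,
      lrxOn_onRow g i R.swap _, lrxOn_onRow g i R _⟩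
  | .alice s P Q, σ => by
    simp only [KWTree.compose]
    exact ⟨σ, 0, Or.inl ⟨⟨s, fun X => rfl⟩, rfl, rfl⟩, le_rfl, lrxOn_compose g R P σ, lrxOn_compose g R Q σ⟩
  | .bob s P Q, σ => by
    simp only [KWTree.compose]
    exact ⟨σ, 0, Or.inl ⟨⟨s, fun X => rfl⟩, rfl, rfl⟩, le_rfl, lrxOn_compose g R P σ, lrxOn_compose g R Q σ⟩

/-- **Independent play is LRB.** -/
theorem lrb_compose (g : (Fin n → Bool) → Bool) (R : KWTree (Fin n)) (Q : KWTree (Fin m)) :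
    LRBDisciplined g (KWTree.compose g R Q) :=
  lrxOn_compose g R Q _

/-- From any `KW_f` protocol `Q` and `KW_g` protocol `R`, an LRB protocol for the strong game of depth `Q.depth + R.depth + 1`. -/
theorem exists_lrb_solvesStrong {f : (Fin m → Bool) → Bool} {g : (Fin n → Bool) → Bool}
    {Q : KWTree (Fin m)} {R : KWTree (Fin n)} (hQ : Q.Solves f) (hR : R.Solves g) :
    ∃ P : KWTree (Fin m × Fin n), LRBDisciplined g P ∧ P.SolvesStrong f g ∧
      P.depth = Q.depth + R.depth + 1 :=
  ⟨KWTree.compose g R Q, lrb_compose g R Q, KWTree.solvesStrong_compose hQ hR, KWTree.depth_compose g R Q⟩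

end NonVacuity

end Summit.PneNP.PneNP.Theorems.KrwLrb
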